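import Literature.NumberTheory.GaloisCohomology.KolyvaginSystems
import HarnessLib

/-!
# Rescaling Kolyvagin systems along a change of the finite–singular comparison data by units
# (cell `b2b-bsdres`, team n1011, sub-target T-a3-F1 — route (A) of skel/T-a3-F1-S2.md §5; seat p13)

HONEST FRAMING (cell `b2b-bsdres`, run/shared/lean/b2b/bsd-rank1-residual/, verbatim in every
file): the goal of the cell is to DELETE the COMBINATION-SHAPED residual classes of the
Birch–Swinnerton-Dyer formula for ALL analytic-rank `≤ 1` elliptic curves over `ℚ` — "full BSD
formula for every rank `≤ 1` curve in class `C`" assembled STRICTLY from published theorems — so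
that the rank-`≤ 1` remainder becomes exactly the CONSTRUCTION-SHAPED classes, which are TYPED
(missing-input `Prop`s), NOT attempted. This is not "finishing BSD". Team n1011: prove what is
provable now; no claim beyond stated classes. Theorems only (no definition, no named fact); pure
algebra on the tree's `KolyvaginDatum` / `kolyvaginSystems` (n1011-lit, `KolyvaginSystems.lean`);
nothing is booked; no label changes.

## What and why

The typed form of Sakamoto's Thm. 4.4 (T-a3-F1) must not be STRONGER than print: the printed
theorem is about THE canonical finite–singular comparison maps `φ^{fs}_𝔮` (Mazur–Rubin Def. 1.2.2,
Rubin PCMS Def. 1.9.6), while the tree's `KolyvaginDatum` carries `fs` as a slot. Route (A) of the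
team's Stage-2b note (skel/T-a3-F1-S2.md §5; lead R5-8 (c); referee 1 to rule) types Thm. 4.4 over
all ADMISSIBLE data (`KolyvaginDatum.IsAdmissible`) plus local freeness, and records why this is
print-EQUIVALENT: two admissible data differ at each Kolyvagin prime by a unit `u_𝔮 ∈ (ℤ/p^m)^×`,
and `κ_d ↦ (∏_{𝔮 ∈ d} u_𝔮) κ_d` identifies the two groups of Kolyvagin systems, preserving the
ideals `I_R(κ_d)`. This file proves that rescaling statement in the tree's vocabulary:

* `isKolyvaginSystem_rescale` — if `D'` has the same primes and transverse conditions as `D` and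
  `φ'^{fs}_𝔮 = u_𝔮 · φ^{fs}_𝔮` on `𝒫` (integers `u_𝔮`), then `κ ∈ KS(D, 𝓕) ⟹ (d ↦ (∏_{𝔮∈d} u_𝔮) κ_d) ∈ KS(D', 𝓕)`
  (the finite–singular relation picks up exactly the factor `u_𝔮` on both sides);
* `exists_kolyvaginSystems_addEquiv_rescale` — if moreover integers `w_𝔮` invert the `u_𝔮` on the
  groups involved (`(w_𝔮 u_𝔮) · x = x` on `H¹(K, T)` and on the singular quotients — automatic for
  `p^m`-torsion groups and `u_𝔮 w_𝔮 ≡ 1 (mod p^m)`), the rescaling is an additive ISOMORPHISM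
  `KS(D, 𝓕) ≃+ KS(D', 𝓕)` acting by `κ_d ↦ (∏_{𝔮∈d} u_𝔮) κ_d`;
* `idealOfElement_zsmul_of_isUnit` — `I_S(k · m) = I_S(m)` for `k` a unit of `S` (so Thm. 4.4 (2)'s
  ideals `I_R(κ_d)` are unchanged by the rescaling).

What is NOT here: the statement that two ADMISSIBLE data do differ by units (it needs the local
freeness "`H¹_{/ur}(K_𝔮, T)` free of rank one over `ℤ/p^m`", Rubin Ex. 1.9.7 — a hypothesis of the
typed theorem, where the units are then read off), and Thm. 4.4 itself.

References: R. Sakamoto, JTNB 36 (2024) §4, Def. 4.1, Def. 4.2, Rem. 4.3 (pp. 925–926)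
[Sakamoto2024]; K. Rubin, PCMS 18 (2011) Def. 1.9.6, Ex. 1.9.7, Def. 2.2.1 [Rubin2011]; B. Mazur,
K. Rubin, Mem. AMS 799 (2004) Def. 1.2.2, Lemma 1.2.3.
-/

noncomputable section

open scoped Classical NumberField
open Field NumberField IsDedekindDomain
open Literature.NumberTheory.GaloisRepresentations Literature.NumberTheory.GaloisRepresentations.DiscreteGaloisModule
  Literature.NumberTheory.GaloisCohomology

namespace Summit.BirchSwinnertonDyer.Rank1Residual.GaloisImage

universe u

variable {K : Type u} [Field K] [NumberField K] {M : Type u} [AddCommGroup M] [TopologicalSpace M]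
  [DiscreteTopology M] {ρ : DiscreteGaloisModule K M}

/-- A product of integers each acting trivially acts trivially. [folklore] -/
theorem finset_prod_smul_eq_self {A : Type*} [AddCommGroup A] {ι : Type*} (c : ι → ℤ)
    (hc : ∀ i (x : A), c i • x = x) (s : Finset ι) (x : A) : (∏ i ∈ s, c i) • x = x := by
  induction s using Finset.induction_on with
  | empty => rw [Finset.prod_empty, one_smul]
  | insert i s hi ih => rw [Finset.prod_insert hi, mul_smul, ih, hc]

/-- **Rescaling a Kolyvagin system along `φ'^{fs} = u · φ^{fs}`.** Let `D, D'` be Kolyvagin data for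
`ρ` with the same Kolyvagin primes and transverse conditions, and with comparison maps related on
`𝒫` by integers `u_𝔮`: `φ'^{fs}_𝔮 = u_𝔮 · φ^{fs}_𝔮`. If `κ = (κ_d)` is a Kolyvagin system for
`(D, 𝓕)`, then `d ↦ (∏_{𝔮 ∈ d} u_𝔮) · κ_d` is a Kolyvagin system for `(D', 𝓕)`: the support and
Selmer conditions are unchanged, and the finite–singular relation at `𝔮 ∉ d` reads
`v_𝔮((u_𝔮 ∏_d u) κ_{d𝔮}) = u_𝔮 (∏_d u) φ^{fs}_𝔮(κ_d) = φ'^{fs}_𝔮((∏_d u) κ_d)`.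
[cite: Sakamoto2024, Def. 4.1 (p. 926) and Rem. 4.3] [cite: Rubin2011, Def. 2.2.1 (p. 18)] -/
theorem isKolyvaginSystem_rescale {D D' : KolyvaginDatum ρ} (u : HeightOneSpectrum (𝓞 K) → ℤ)
    (hP : D'.primes = D.primes) (hT : D'.transverse = D.transverse)
    (hfs : ∀ q ∈ D.primes, ∀ x, D'.fs q x = u q • D.fs q x)
    {𝓕 : SelmerStructure ρ} {κ : Finset (HeightOneSpectrum (𝓞 K)) → galoisCohomology ρ 1}
    (hκ : D.IsKolyvaginSystem 𝓕 κ) :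
    D'.IsKolyvaginSystem 𝓕 (fun d => (∏ q ∈ d, u q) • κ d) := by
  have hlev : ∀ d, D'.IsLevel d ↔ D.IsLevel d := fun d => by
    simp only [KolyvaginDatum.IsLevel, hP]
  have hat : ∀ d, D'.atLevel 𝓕 d = D.atLevel 𝓕 d := fun d => by
    simp only [KolyvaginDatum.atLevel, hT]
  refine ⟨fun d hd => ?_, fun d hd => ?_, fun d hd q hq hqd => ?_⟩
  · rw [hκ.eq_zero_of_not_isLevel d (fun h => hd ((hlev d).mpr h)), smul_zero]
  · rw [hat]
    exact AddSubgroup.zsmul_mem _ (hκ.mem_selmerGroup d ((hlev d).mp hd)) _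
  · rw [hP] at hq
    have hrel := hκ.fs_rel d ((hlev d).mp hd) q hq hqd
    have hloc : ∀ y : galoisCohomology ρ 1,
        D'.fsLocalization q y = u q • D.fsLocalization q y := fun y => hfs q hq _
    rw [Finset.prod_insert hqd, map_zsmul, map_zsmul, hrel, hloc, smul_smul, mul_comm]

/-- **The rescaling is an isomorphism `KS(D, 𝓕) ≃+ KS(D', 𝓕)` when the `u_𝔮` are invertible on the
groups involved**: given integers `w_𝔮` with `(w_𝔮 u_𝔮) · x = x` for all `x ∈ H¹(K, T)` and all `x`
in the singular quotients `H¹_{/ur}(K_𝔮, T)` (for a `p^m`-torsion `T` and `u_𝔮 w_𝔮 ≡ 1 (mod p^m)`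
this is automatic), `κ ↦ (d ↦ (∏_{𝔮∈d} u_𝔮) κ_d)` is an additive equivalence between the Kolyvagin
systems of `D` and of `D'`, with inverse the rescaling by the `w_𝔮`. Hence a statement about the
Kolyvagin systems of ALL such data is equivalent to the same statement for ONE of them (route (A) of
the team's Stage-2b note). [cite: Sakamoto2024, Def. 4.1 and Rem. 4.3 (p. 926)]
[cite: Rubin2011, Exercise 1.9.7 (p. 15) and Def. 2.2.1 (p. 18)] -/
theorem exists_kolyvaginSystems_addEquiv_rescale {D D' : KolyvaginDatum ρ}
    (u w : HeightOneSpectrum (𝓞 K) → ℤ)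
    (hP : D'.primes = D.primes) (hT : D'.transverse = D.transverse)
    (hfs : ∀ q ∈ D.primes, ∀ x, D'.fs q x = u q • D.fs q x)
    (huw : ∀ q (x : galoisCohomology ρ 1), (w q * u q) • x = x)
    (huw' : ∀ q (y : SingularQuotient (GaloisRep.toLocal q ρ)), (w q * u q) • y = y)
    (𝓕 : SelmerStructure ρ) :
    ∃ e : D.kolyvaginSystems 𝓕 ≃+ D'.kolyvaginSystems 𝓕,
      ∀ (κ : D.kolyvaginSystems 𝓕) (d : Finset (HeightOneSpectrum (𝓞 K))),
        (e κ).1 d = (∏ q ∈ d, u q) • κ.1 d := by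
  -- the inverse relation `φ^{fs} = w · φ'^{fs}` on `𝒫`
  have hfs' : ∀ q ∈ D'.primes, ∀ x, D.fs q x = w q • D'.fs q x := by
    intro q hq x
    rw [hP] at hq
    rw [hfs q hq x, smul_smul, huw']
  have hwu : ∀ (d : Finset (HeightOneSpectrum (𝓞 K))) (x : galoisCohomology ρ 1),
      (∏ q ∈ d, w q) • (∏ q ∈ d, u q) • x = x := fun d x => by
    rw [smul_smul, ← Finset.prod_mul_distrib]
    exact finset_prod_smul_eq_self (fun q => w q * u q) huw d x
  have huw2 : ∀ (d : Finset (HeightOneSpectrum (𝓞 K))) (x : galoisCohomology ρ 1),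
      (∏ q ∈ d, u q) • (∏ q ∈ d, w q) • x = x := fun d x => by
    rw [smul_smul, ← Finset.prod_mul_distrib]
    refine finset_prod_smul_eq_self (fun q => u q * w q) (fun q y => ?_) d x
    rw [mul_comm]
    exact huw q y
  refine ⟨{ toFun := fun κ => ⟨fun d => (∏ q ∈ d, u q) • κ.1 d,
              (KolyvaginDatum.mem_kolyvaginSystems_iff _ _ _).mpr
                (isKolyvaginSystem_rescale u hP hT hfs
                  ((KolyvaginDatum.mem_kolyvaginSystems_iff _ _ _).mp κ.2))⟩
            invFun := fun κ' => ⟨fun d => (∏ q ∈ d, w q) • κ'.1 d,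
              (KolyvaginDatum.mem_kolyvaginSystems_iff _ _ _).mpr
                (isKolyvaginSystem_rescale w hP.symm hT.symm hfs'
                  ((KolyvaginDatum.mem_kolyvaginSystems_iff _ _ _).mp κ'.2))⟩
            left_inv := fun κ => Subtype.ext (funext fun d => hwu d _)
            right_inv := fun κ' => Subtype.ext (funext fun d => huw2 d _)
            map_add' := fun κ₁ κ₂ => Subtype.ext (funext fun d => ?_) }, fun κ d => rfl⟩
  change (∏ q ∈ d, u q) • (κ₁.1 d + κ₂.1 d) = (∏ q ∈ d, u q) • κ₁.1 d + (∏ q ∈ d, u q) • κ₂.1 d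
  rw [smul_add]

/-- **`I_S(k · m) = I_S(m)` for `k` invertible in `S`**: the ideal `{f(m) : f ∈ Hom_S(N, S)}` of
Sakamoto Def. 4.2 (tree `KolyvaginSystem.idealOfElement`) is unchanged when `m` is replaced by a
unit multiple — so Thm. 4.4 (2)'s `I_R(κ_d)` is invariant under the rescaling
`κ_d ↦ (∏_{𝔮∈d} u_𝔮) κ_d` by units. [cite: Sakamoto2024, Def. 4.2 and Rem. 4.3 (p. 926)] -/
theorem idealOfElement_zsmul_of_isUnit (S : Type*) [CommRing S] {N : Type*} [AddCommGroup N]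
    [Module S N] (m : N) (k : ℤ) (hk : IsUnit (k : S)) :
    KolyvaginSystem.idealOfElement S (k • m) = KolyvaginSystem.idealOfElement S m := by
  obtain ⟨c, hc⟩ := hk.exists_left_inv
  ext s
  rw [KolyvaginSystem.mem_idealOfElement_iff, KolyvaginSystem.mem_idealOfElement_iff]
  constructor
  · rintro ⟨f, rfl⟩
    refine ⟨(k : S) • f, ?_⟩
    rw [LinearMap.smul_apply, ← Int.cast_smul_eq_zsmul S k m, map_smul]
  · rintro ⟨f, rfl⟩
    refine ⟨c • f, ?_⟩
    rw [LinearMap.smul_apply, ← Int.cast_smul_eq_zsmul S k m, map_smul, smul_smul, hc, one_smul]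

end Summit.BirchSwinnertonDyer.Rank1Residual.GaloisImage

end
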